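import Mathlib.NumberTheory.ZetaValues
import Mathlib.NumberTheory.Bernoulli
import Mathlib.Analysis.SpecialFunctions.Gaussian.GaussianIntegral
import Mathlib.MeasureTheory.Integral.Gamma
import Literature.NumberTheory.LFunctions.WeilExplicit
import Literature.NumberTheory.LFunctions.ZetaZeros
import Literature.NumberTheory.LFunctions.RHWave0
import HarnessLib

/-!
# Connes 2024, *Heat expansion and zeta* — the heat-trace asymptotics of the zeta zeros (STATEMENT LAYER; §4 PROVED)

LABEL (line 1): RH-FREE literature typing of a theorem that is CONDITIONAL ON RH as printed ("Assume RH …"):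
the named fact below is the implication `RiemannHypothesis → (asymptotic expansion)`; nothing here bears on the
truth of RH, and nothing is worded as progress toward it.  WHAT THIS IS NOT: a construction of an operator `D`
with spectrum the zeta zeros (the operator is "putative" in print); a convergence claim for the series
`Σ a_n t^{n/2}` (it diverges factorially, as the source stresses).

Source: A. Connes, *Heat expansion and zeta*, Ann. Funct. Anal. 15 (2024), no. 3, Paper No. 59
(= arXiv:2402.13082) [bib `Connes2024HeatExpansion`; held text `paper:arxiv-2402.13082`, chunk locators
`pNNNN:Lnn`], quoted verbatim as Theorem 7.3 of A. Connes, *The Riemann Hypothesis: past, present and a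
letter through time*, arXiv:2602.04022 §7.5 [`Connes2026Letter`].  Cell `rh-crit`, sub-cell `cc/`, row O1
(Letter §7): this file carries the Letter's Theorem 7.3; the rest of Letter §7 is
`Literature/NumberTheory/Connes2026/LetterSemilocal.lean`.

## What is printed and what is typed

* **Theorem 1.1** (p0002:L8–L14) — NAMED FACT `Connes2024_heat_thm_1_1` (see its docstring for the verbatim
  statement and the typing): under RH, `Tr(e^{−tD²}) = Σ_ρ m(ρ) e^{−t(Im ρ)²}` (`zetaHeatTrace`) has the
  asymptotic expansion `heatMainTerm t + Σ a_n t^{n/2}` as `t → 0⁺`.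
* **eq. (1.2)** the Euler numbers `E(2n)` by the printed double sum — DEFINITION `connesEuler` (`E(0) := 1`),
  with `E(2) = −1`, `E(4) = 5`, `E(6) = −61` PROVED from the printed formula.
* **Lemma 3.1** the Taylor coefficients `b_n` of `r(u) = e^{u/2}/(e^u − e^{−u}) − 1/(2u)` —
  DEFINITION `heatCoeffB` (the convergence statement `|u| < π` is not typed); **Lemma 3.2**
  `a_n = −2^n Γ((n+1)/2) b_n/√π` — taken as the DEFINITION `heatCoeff` of `a_n`, and the closed forms of
  Theorem 1.1 (`a_0 = −1/4`, `a_{2k−1}`, `a_{2k}`) PROVED from it (`heatCoeff_zero`, `heatCoeff_odd`,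
  `heatCoeff_even`), together with the two printed numerical coefficients `a_1 = 1/(24√π)`, `a_2 = 1/16`
  of the §4 check "`7/4 + √t/(24√π) + 9t/16`" (`heatCoeff_one`, `heatCoeff_two`).
* **§3 first display** `F_t(e^y) = e^{−y²/4t}/(2√π√t)` — `heatTest` (additive avatar of the tree's Weil layer);
  **§4 first display** `ψ(t) = Σ Λ(n) n^{−1/2} e^{−(log n)²/4t}/(√π√t)` — `heatPrimeSum`, `= weilPrimeTerm (heatTest t)`
  (`weilPrimeTerm_heatTest`, PROVED).
* **§4, the displayed estimate** "for `t ≤ t_0 = (log 6)/8`, `|ψ(t)| ≤ 4(π²/6 − 1) e^{−(log 2)²/4t}/(√π√t)`" —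
  PROVED (`abs_heatPrimeSum_le`, with the printed termwise inequality `exp_neg_log_sq_le` and "`Λ(n)n^{−1/2}
  ≤ 1`" `vonMangoldt_div_sqrt_le_one`).
* **Lemma 3.2, display (3.6)** the Gaussian moments `∫_0^∞ 2F_t(e^y) y^n dy = 2^n t^{n/2} Γ((n+1)/2)/√π` —
  PROVED (`integral_two_heatTest_mul_pow`).
* NOT TYPED (numbered statements of the source outside the Letter's quotation): Lemma 3.1's convergence
  claim, Lemma 3.2's asymptotic expansion of `∫ 2F_t(e^u) r(u) du` (steps of the proof of Thm 1.1),
  Theorem 5.1 (counting function `N(E) = (E/2π)(log(E/2π) − 1) + O(log E)` ⇒ the two leading heat terms,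
  an RH-free Tauberian statement about an abstract symmetric discrete spectrum), the display `Σ_Z e^{−tρ²} = 2e^{t/4} − W_ℝ(F_t) − ψ(t)` of §3 (the explicit
  formula for the Gaussian `F_t`, which is NOT an `IsWeilTest` function of the tree — compact support — so
  the tree's `explicit_formula_holds` does not apply verbatim; this is the one analytic input a discharge of
  `Connes2024_heat_thm_1_1` would need).

Vocabulary reused (no parallel vocabulary): `RHWave0.riemannZetaNontrivialZeros`, `riemannZetaZeroOrder`,
`weilPrimeTerm`, Mathlib's `RiemannHypothesis`, `bernoulli`, `Real.Gamma`, `hasSum_zeta_two`.  No instance,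
notation or attribute is declared; the only `def … : Prop` without proof is `Connes2024_heat_thm_1_1`.
-/

noncomputable section

open Complex Filter Set MeasureTheory Finset Asymptotics
open scoped Real Topology ArithmeticFunction.vonMangoldt

namespace Literature.NumberTheory.LFunctions

/-! ## The Euler numbers `E(2n)` as printed (eq. (1.2)) and the coefficients `b_n`, `a_n` -/

/-- **The Euler numbers `E(2n)`** in the closed form printed in Connes 2024 eq. (1.2) (= the display in Letter Thm 7.3):
`E(2n) := Σ_{k=1}^{2n} (−1/2)^k Σ_{j=0}^{2k} (−1)^j binom(2k, j) (k − j)^{2n}` for `n ≥ 1`, and `E(0) := 1`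
(the usual convention, consistent with `a_0 = −1/4` below); `E(2) = −1`, `E(4) = 5`, `E(6) = −61`
(`connesEuler_one`, `_two`, `_three`).  Rational-valued as printed (the values are integers).
[cite: Connes2024HeatExpansion, eq. (1.2) (arXiv p0002:L16); Connes2026Letter, Thm 7.3, display defining E(2n) (arXiv p0026:L18)] -/
def connesEuler (n : ℕ) : ℚ :=
  if n = 0 then 1 else
    ∑ k ∈ Finset.Icc 1 (2 * n), (-1 / 2 : ℚ) ^ k *
      ∑ j ∈ range (2 * k + 1), (-1 : ℚ) ^ j * ((2 * k).choose j : ℚ) * ((k : ℚ) - j) ^ (2 * n)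

/-- `E(0) = 1`. [cite: Connes2024HeatExpansion, eq. (1.2) (arXiv p0002:L16)] -/
theorem connesEuler_zero : connesEuler 0 = 1 := by simp [connesEuler]

/-- `E(2) = −1` from the printed double sum. [cite: Connes2024HeatExpansion, eq. (1.2) (arXiv p0002:L16)] -/
theorem connesEuler_one : connesEuler 1 = -1 := by
  rw [connesEuler, if_neg one_ne_zero, show Finset.Icc 1 (2 * 1) = {1, 2} by decide]
  norm_num [Finset.sum_range_succ, Nat.choose]

/-- `E(4) = 5` from the printed double sum. [cite: Connes2024HeatExpansion, eq. (1.2) (arXiv p0002:L16)] -/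
theorem connesEuler_two : connesEuler 2 = 5 := by
  rw [connesEuler, if_neg two_ne_zero, show Finset.Icc 1 (2 * 2) = {1, 2, 3, 4} by decide]
  norm_num [Finset.sum_range_succ, Nat.choose]

/-- `E(6) = −61` from the printed double sum. [cite: Connes2024HeatExpansion, eq. (1.2) (arXiv p0002:L16)] -/
theorem connesEuler_three : connesEuler 3 = -61 := by
  rw [connesEuler, if_neg (by norm_num), show Finset.Icc 1 (2 * 3) = {1, 2, 3, 4, 5, 6} by decide]
  norm_num [Finset.sum_range_succ, Nat.choose]


/-- **The Taylor coefficients `b_n` of `r(u) = e^{u/2}/(e^u − e^{−u}) − 1/(2u)`** (Connes 2024 Lemma 3.1,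
display (tayll)): `b_0 = 1/4`, `b_{2k−1} = −(1 − 2^{1−2k}) B_{2k}/(2 (2k)!)`, `b_{2k} = (1/4) 2^{−2k} E(2k)/(2k)!`, with
Mathlib's `bernoulli` (`B_{2k}`, `k ≥ 1`, where both Bernoulli conventions agree) and `connesEuler`.  Written by
parity of `n` (odd `n = 2k − 1`: `2^{1−2k} = 2/2^{n+1}`, `B_{2k} = bernoulli (n+1)`; even `n = 2k`, including
`n = 0` via `E(0) = 1`). DEFINITION (the convergence statement of Lemma 3.1 is not typed here).
[cite: Connes2024HeatExpansion, Lemma 3.1 (arXiv p0006:L1)] -/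
def heatCoeffB (n : ℕ) : ℝ :=
  if Even n then (connesEuler (n / 2) : ℝ) / (4 * 2 ^ n * (n.factorial : ℝ))
  else -(1 - 2 / 2 ^ (n + 1)) * (bernoulli (n + 1) : ℝ) / (2 * ((n + 1).factorial : ℝ))

/-- **The heat coefficients `a_n := −2^n Γ((n+1)/2) b_n / √π`** (Connes 2024 Lemma 3.2, its display); the closed
forms printed in Theorem 1.1 (`a_0 = −1/4`, `a_{2k−1} = Γ(k)(2^{2k−1} − 1)B_{2k}/(2√π(2k)!)`,
`a_{2k} = −(1/4)Γ(k+1/2)E(2k)/(√π(2k)!)`) are PROVED below (`heatCoeff_zero`, `heatCoeff_odd`, `heatCoeff_even`).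
[cite: Connes2024HeatExpansion, Lemma 3.2 (arXiv p0006:L40); Thm 1.1 (arXiv p0002:L8)] -/
def heatCoeff (n : ℕ) : ℝ :=
  -(2 ^ n * Real.Gamma (((n : ℝ) + 1) / 2) * heatCoeffB n / √π)

/-- `b_0 = 1/4`. [cite: Connes2024HeatExpansion, Lemma 3.1 (arXiv p0006:L1)] -/
theorem heatCoeffB_zero : heatCoeffB 0 = 1 / 4 := by
  simp [heatCoeffB, connesEuler_zero]

/-- **`a_0 = −1/4`** (Thm 1.1), from `Γ(1/2) = √π`. [cite: Connes2024HeatExpansion, Thm 1.1 (arXiv p0002:L12)] -/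
theorem heatCoeff_zero : heatCoeff 0 = -(1 / 4) := by
  have hπ : (0 : ℝ) < √π := Real.sqrt_pos.mpr Real.pi_pos
  rw [heatCoeff, heatCoeffB_zero]
  norm_num [Real.Gamma_one_half_eq, hπ.ne']

/-- **`a_{2k} = −(1/4) Γ(k + 1/2) E(2k)/(√π (2k)!)`** (Thm 1.1, even coefficients, `k ≥ 0`). PROVED from the
definition via Lemma 3.2. [cite: Connes2024HeatExpansion, Thm 1.1 (arXiv p0002:L13)] -/
theorem heatCoeff_even (k : ℕ) :
    heatCoeff (2 * k) =
      -(1 / 4) * Real.Gamma (k + 1 / 2) * (connesEuler k : ℝ) / (√π * ((2 * k).factorial : ℝ)) := by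
  have hπ : (0 : ℝ) < √π := Real.sqrt_pos.mpr Real.pi_pos
  have h2 : (2 : ℝ) ^ (2 * k) ≠ 0 := pow_ne_zero _ two_ne_zero
  have hf : ((2 * k).factorial : ℝ) ≠ 0 := by positivity
  rw [heatCoeff, heatCoeffB, if_pos (even_two_mul k), Nat.mul_div_cancel_left k two_pos]
  have harg : (((2 * k : ℕ) : ℝ) + 1) / 2 = (k : ℝ) + 1 / 2 := by push_cast; ring
  rw [harg]
  field_simp

/-- **`a_{2k+1} = Γ(k+1) (2^{2k+1} − 1) B_{2k+2}/(2√π (2k+2)!)`** (Thm 1.1, odd coefficients: the printed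
`a_{2k−1} = Γ(k)(2^{2k−1} − 1)B_{2k}/(2√π(2k)!)` with `k ↦ k+1`). PROVED from the definition via Lemma 3.2.
[cite: Connes2024HeatExpansion, Thm 1.1 (arXiv p0002:L13)] -/
theorem heatCoeff_odd (k : ℕ) :
    heatCoeff (2 * k + 1) =
      Real.Gamma (k + 1) * (2 ^ (2 * k + 1) - 1) * (bernoulli (2 * k + 2) : ℝ) /
        (2 * √π * ((2 * k + 2).factorial : ℝ)) := by
  have hπ : (0 : ℝ) < √π := Real.sqrt_pos.mpr Real.pi_pos
  have h2 : (2 : ℝ) ^ (2 * k + 1 + 1) ≠ 0 := pow_ne_zero _ two_ne_zero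
  have hf : ((2 * k + 1 + 1).factorial : ℝ) ≠ 0 := by positivity
  have hodd : ¬ Even (2 * k + 1) := Nat.not_even_iff_odd.mpr (odd_two_mul_add_one k)
  rw [heatCoeff, heatCoeffB, if_neg hodd]
  have harg : (((2 * k + 1 : ℕ) : ℝ) + 1) / 2 = (k : ℝ) + 1 := by push_cast; ring
  rw [harg, show 2 * k + 2 = 2 * k + 1 + 1 from rfl]
  field_simp
  ring

/-- `a_1 = 1/(24√π)` (`B_2 = 1/6`): the coefficient of `√t` in the printed numerical check (§4, display
before (zetaheat1): "`… + 7/4 + √t/(24√π) + 9t/16`"). [cite: Connes2024HeatExpansion, §4 (arXiv p0007:L22)] -/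
theorem heatCoeff_one : heatCoeff 1 = 1 / (24 * √π) := by
  have h := heatCoeff_odd 0
  have hB : (bernoulli 2 : ℝ) = 1 / 6 := by
    rw [bernoulli_eq_bernoulli'_of_ne_one (by norm_num), bernoulli'_two]; norm_num
  simp only [Nat.mul_zero, Nat.cast_zero, zero_add] at h
  rw [h, Real.Gamma_one, hB]
  norm_num [Nat.factorial]
  ring

/-- `a_2 = 1/16` (`E(2) = −1`, `Γ(3/2) = √π/2`): with `2e^{t/4} = 2 + t/2 + …` this is the printed `9t/16`
(§4). [cite: Connes2024HeatExpansion, §4 (arXiv p0007:L22)] -/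
theorem heatCoeff_two : heatCoeff 2 = 1 / 16 := by
  have h := heatCoeff_even 1
  have hπ : (0 : ℝ) < √π := Real.sqrt_pos.mpr Real.pi_pos
  have hG : Real.Gamma ((1 : ℕ) + 1 / 2 : ℝ) = √π / 2 := by
    rw [show ((1 : ℕ) + 1 / 2 : ℝ) = 1 / 2 + 1 by norm_num, Real.Gamma_add_one (by norm_num),
      Real.Gamma_one_half_eq]
    ring
  rw [show (2 : ℕ) = 2 * 1 from rfl, h, hG, connesEuler_one]
  norm_num [Nat.factorial]
  field_simp
  ring

/-! ## The test function `F_t`, the prime sum `ψ(t)` (§4) and its bound — PROVED -/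

/-- The heat test function `F_t(e^y) = e^{−y²/4t}/(2√π√t)` (Connes 2024 §3, first display: the function with
`F̂_t(s) = e^{−ts²}`), as the additive avatar `g_t(y) = F_t(e^y)` of the tree's Weil layer (complex-valued).
Not compactly supported (so not an `IsWeilTest` function). [cite: Connes2024HeatExpansion, §3 first display (arXiv p0005:L4)] -/
def heatTest (t : ℝ) (y : ℝ) : ℂ :=
  ((Real.exp (-y ^ 2 / (4 * t)) / (2 * √π * √t) : ℝ) : ℂ)

/-- The `n`-th term of `ψ(t)`: `Λ(n) n^{−1/2} e^{−(log n)²/4t}/(√π√t)`. [cite: Connes2024HeatExpansion, §4 first display (arXiv p0007:L3)] -/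
def heatPrimeTerm (t : ℝ) (n : ℕ) : ℝ :=
  (Λ n : ℝ) / Real.sqrt n * (Real.exp (-Real.log n ^ 2 / (4 * t)) / (√π * √t))

/-- **The contribution of the primes** `ψ(t) := Σ_p W_p(F_t) = 2 Σ_{n≥2} Λ(n) n^{−1/2} F_t(n) =
Σ_{n≥2} Λ(n) n^{−1/2} e^{−(log n)²/4t}/(√π√t)` (Connes 2024 §4, first display); the `n = 0, 1` terms vanish
(`Λ = 0`).  This is the tree's `weilPrimeTerm (heatTest t)` (same `Λ(n) n^{-1/2}(g(log n) + g(−log n))`).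
[cite: Connes2024HeatExpansion, §4 first display (arXiv p0007:L3)] -/
def heatPrimeSum (t : ℝ) : ℝ := ∑' n : ℕ, heatPrimeTerm t n

/-- `log n ≤ √n` for `n > 0`… more precisely `Λ(n) n^{-1/2} ≤ 1` for every `n` ("since `Λ(n) n^{−1/2} ≤ 1`",
§4): `Λ(n) ≤ log n = 2 log √n ≤ √n` because `log s ≤ s/2` (`log(s/2) ≤ s/2 − 1`, `log 2 ≤ 1`).
[cite: Connes2024HeatExpansion, §4 (arXiv p0007:L12)] -/
theorem vonMangoldt_div_sqrt_le_one (n : ℕ) : (Λ n : ℝ) / Real.sqrt n ≤ 1 := by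
  rcases Nat.eq_zero_or_pos n with rfl | hn
  · simp
  have hn' : (0 : ℝ) < n := by exact_mod_cast hn
  have hs : 0 < Real.sqrt n := Real.sqrt_pos.mpr hn'
  rw [div_le_one hs]
  have h1 : (Λ n : ℝ) ≤ Real.log n := ArithmeticFunction.vonMangoldt_le_log
  have h2 : Real.log n = 2 * Real.log (Real.sqrt n) := by
    rw [← Real.log_rpow hs, show (2:ℝ) = (2:ℕ) by norm_num, Real.rpow_natCast, Real.sq_sqrt hn'.le]
  have h3 : Real.log (Real.sqrt n) ≤ Real.sqrt n / 2 := by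
    have ha : Real.log (Real.sqrt n / 2) ≤ Real.sqrt n / 2 - 1 := Real.log_le_sub_one_of_pos (by positivity)
    have hb : Real.log 2 ≤ 1 := by
      have := Real.log_le_sub_one_of_pos (show (0:ℝ) < 2 by norm_num); linarith
    have hc : Real.log (Real.sqrt n) = Real.log (Real.sqrt n / 2) + Real.log 2 := by
      rw [Real.log_div hs.ne' two_ne_zero]; ring
    linarith
  linarith

/-- The terms of `ψ(t)` are non-negative. [cite: Connes2024HeatExpansion, §4 first display (arXiv p0007:L3)] -/
theorem heatPrimeTerm_nonneg {t : ℝ} (ht : 0 < t) (n : ℕ) : 0 ≤ heatPrimeTerm t n := by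
  unfold heatPrimeTerm
  have : 0 ≤ (Λ n : ℝ) := ArithmeticFunction.vonMangoldt_nonneg
  positivity

/-- The terms `n = 0, 1` of `ψ(t)` vanish (`Λ(0) = Λ(1) = 0`). [cite: Connes2024HeatExpansion, §4 first display (arXiv p0007:L3)] -/
theorem heatPrimeTerm_eq_zero_of_lt_two (t : ℝ) {n : ℕ} (hn : n < 2) : heatPrimeTerm t n = 0 := by
  interval_cases n <;> simp [heatPrimeTerm, ArithmeticFunction.vonMangoldt_apply_one]

/-- **The termwise inequality of §4**: for `n ≥ 2` and `0 < t ≤ t_0 = (log 6)/8`,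
`e^{−(log n)²/4t} ≤ 4 n^{−2} e^{−(log 2)²/4t}` ("One has for any integer `n ≥ 2` and `t ≤ t_0 = (log 6)/8 ∼
0.22397`, the inequality …"). PROVED: with `a = log n ≥ b = log 2` it reads `(a − b)(a + b − 8t) ≥ 0`; for
`n = 2` the first factor vanishes, for `n ≥ 3` `a + b ≥ log 6 ≥ 8t`. [cite: Connes2024HeatExpansion, §4 (arXiv p0007:L8)] -/
theorem exp_neg_log_sq_le {t : ℝ} (ht : 0 < t) (ht0 : t ≤ Real.log 6 / 8) {n : ℕ} (hn : 2 ≤ n) :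
    Real.exp (-Real.log n ^ 2 / (4 * t)) ≤ 4 / (n : ℝ) ^ 2 * Real.exp (-Real.log 2 ^ 2 / (4 * t)) := by
  have hn0 : (0 : ℝ) < n := by exact_mod_cast (lt_of_lt_of_le two_pos hn)
  set a := Real.log n with ha
  set b := Real.log 2 with hb
  -- `4 / n² = e^{2b − 2a}`
  have h4 : (4 : ℝ) / (n : ℝ) ^ 2 = Real.exp (2 * b - 2 * a) := by
    rw [show 2 * b = Real.log ((2 : ℝ) ^ 2) by rw [Real.log_pow, hb]; norm_num,
      show 2 * a = Real.log ((n : ℝ) ^ 2) by rw [Real.log_pow, ha]; norm_num,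
      Real.exp_sub, Real.exp_log (by positivity), Real.exp_log (by positivity)]
    norm_num
  rw [h4, ← Real.exp_add, Real.exp_le_exp]
  -- reduce to `(a - b) * (a + b - 8t) ≥ 0`
  have hab : b ≤ a := Real.log_le_log two_pos (by exact_mod_cast hn)
  have key : 0 ≤ (a - b) * (a + b - 8 * t) := by
    rcases eq_or_lt_of_le hn with h2 | h3
    · have : a = b := by rw [ha, hb, ← h2]; norm_num
      rw [this, sub_self, zero_mul]
    · have h6 : Real.log 6 ≤ a + b := by
        rw [ha, hb, ← Real.log_mul hn0.ne' two_ne_zero]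
        exact Real.log_le_log (by norm_num) (by
          have : (3 : ℝ) ≤ n := by exact_mod_cast h3
          linarith)
      exact mul_nonneg (sub_nonneg.mpr hab) (by linarith)
  have ht4 : 0 < 4 * t := by linarith
  rw [div_le_iff₀ ht4]
  have hexp : (2 * b - 2 * a + -b ^ 2 / (4 * t)) * (4 * t) = (2 * b - 2 * a) * (4 * t) - b ^ 2 := by
    field_simp
    ring
  rw [hexp]
  nlinarith [key]

/-- Termwise bound for `ψ(t)`: `n ≥ 2`, `0 < t ≤ (log 6)/8` ⇒
`Λ(n) n^{-1/2} e^{−(log n)²/4t}/(√π√t) ≤ (4/n²) e^{−(log 2)²/4t}/(√π√t)`. [cite: Connes2024HeatExpansion, §4 (arXiv p0007:L8–L12)] -/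
theorem heatPrimeTerm_le {t : ℝ} (ht : 0 < t) (ht0 : t ≤ Real.log 6 / 8) {n : ℕ} (hn : 2 ≤ n) :
    heatPrimeTerm t n ≤ 4 / (n : ℝ) ^ 2 * (Real.exp (-Real.log 2 ^ 2 / (4 * t)) / (√π * √t)) := by
  unfold heatPrimeTerm
  have hπt : 0 < √π * √t := mul_pos (Real.sqrt_pos.mpr Real.pi_pos) (Real.sqrt_pos.mpr ht)
  have h1 := vonMangoldt_div_sqrt_le_one n
  have h2 := exp_neg_log_sq_le ht ht0 hn
  have h3 : 0 ≤ (Λ n : ℝ) / Real.sqrt n := div_nonneg ArithmeticFunction.vonMangoldt_nonneg (Real.sqrt_nonneg _)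
  calc (Λ n : ℝ) / Real.sqrt n * (Real.exp (-Real.log n ^ 2 / (4 * t)) / (√π * √t))
      ≤ 1 * (4 / (n : ℝ) ^ 2 * Real.exp (-Real.log 2 ^ 2 / (4 * t)) / (√π * √t)) := by
        gcongr
    _ = 4 / (n : ℝ) ^ 2 * (Real.exp (-Real.log 2 ^ 2 / (4 * t)) / (√π * √t)) := by ring

/-- `Σ_{n ≥ 2} n^{−2} = π²/6 − 1` (Euler; Mathlib's `hasSum_zeta_two`). [cite: Connes2024HeatExpansion, §4 (arXiv p0007:L13)] -/
theorem hasSum_inv_sq_from_two :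
    HasSum (fun n : ℕ => 4 / ((n + 2 : ℕ) : ℝ) ^ 2) (4 * (π ^ 2 / 6 - 1)) := by
  have h2 : HasSum (fun n : ℕ => 1 / ((n + 2 : ℕ) : ℝ) ^ 2)
      (π ^ 2 / 6 - ∑ i ∈ range 2, 1 / ((i : ℕ) : ℝ) ^ 2) :=
    (hasSum_nat_add_iff' 2).mpr hasSum_zeta_two
  have hs : ∑ i ∈ range 2, (1 : ℝ) / ((i : ℕ) : ℝ) ^ 2 = 1 := by simp [Finset.sum_range_succ]
  rw [hs] at h2
  have hf : (fun n : ℕ => 4 / ((n + 2 : ℕ) : ℝ) ^ 2) = fun n => 4 * (1 / ((n + 2 : ℕ) : ℝ) ^ 2) := by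
    ext n; ring
  rw [hf]
  exact h2.mul_left 4

/-- `ψ(t)` converges (non-negative terms dominated by `4n^{−2}·const`) for `0 < t ≤ (log 6)/8`.
[cite: Connes2024HeatExpansion, §4 (arXiv p0007:L13)] -/
theorem summable_heatPrimeTerm {t : ℝ} (ht : 0 < t) (ht0 : t ≤ Real.log 6 / 8) :
    Summable (heatPrimeTerm t) := by
  rw [← summable_nat_add_iff 2]
  refine Summable.of_nonneg_of_le (fun n => heatPrimeTerm_nonneg ht _)
    (fun n => heatPrimeTerm_le ht ht0 (by omega)) ?_
  exact (hasSum_inv_sq_from_two.mul_right _).summable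

/-- **Connes 2024, §4: the primes do not contribute to the expansion** — for `0 < t ≤ t_0 = (log 6)/8`,
`|ψ(t)| ≤ 4 (π²/6 − 1) e^{−(log 2)²/4t}/(√π √t)` ("and one thus obtains, since `Λ(n) n^{−1/2} ≤ 1` the
estimate for `t ≤ t_0` …, which shows that it does not contribute to the asymptotic expansion when `t → 0`").
PROVED (RH-free, elementary). [cite: Connes2024HeatExpansion, §4 second display (arXiv p0007:L13)] -/
theorem abs_heatPrimeSum_le {t : ℝ} (ht : 0 < t) (ht0 : t ≤ Real.log 6 / 8) :
    |heatPrimeSum t| ≤ 4 * (π ^ 2 / 6 - 1) * (Real.exp (-Real.log 2 ^ 2 / (4 * t)) / (√π * √t)) := by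
  have hsum := summable_heatPrimeTerm ht ht0
  have hnonneg : 0 ≤ heatPrimeSum t := tsum_nonneg (heatPrimeTerm_nonneg ht)
  rw [abs_of_nonneg hnonneg, heatPrimeSum, ← Summable.sum_add_tsum_nat_add 2 hsum]
  simp only [Finset.sum_range_succ, Finset.sum_range_zero, zero_add,
    heatPrimeTerm_eq_zero_of_lt_two t zero_lt_two, heatPrimeTerm_eq_zero_of_lt_two t one_lt_two, add_zero]
  have hb := hasSum_inv_sq_from_two.mul_right (Real.exp (-Real.log 2 ^ 2 / (4 * t)) / (√π * √t))
  rw [← hb.tsum_eq]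
  exact Summable.tsum_le_tsum (fun n => heatPrimeTerm_le ht ht0 (by omega))
    ((summable_nat_add_iff 2).mpr hsum) hb.summable

/-- Dictionary with the tree's Weil layer: `ψ(t) = weilPrimeTerm g_t` for the additive avatar `g_t = heatTest t`
(`Σ_n Λ(n) n^{-1/2}(g(log n) + g(−log n))`, and `g_t` is even with `2F_t(n) = e^{−(log n)²/4t}/(√π√t)`).
[cite: Connes2024HeatExpansion, §4 first display (arXiv p0007:L3)] -/
theorem weilPrimeTerm_heatTest (t : ℝ) :
    weilPrimeTerm (heatTest t) = ((heatPrimeSum t : ℝ) : ℂ) := by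
  rw [weilPrimeTerm, heatPrimeSum, Complex.ofReal_tsum]
  refine tsum_congr fun n => ?_
  have heven : heatTest t (-Real.log n) = heatTest t (Real.log n) := by simp [heatTest]
  rw [heven, heatPrimeTerm]
  simp only [heatTest]
  push_cast
  ring

/-- **The Gaussian moments of `F_t`** (Connes 2024, display (3.6) in the proof of Lemma 3.2: "We use the equality
`∫_0^∞ 2F_t(e^y) y^n dy = 2^n t^{n/2} Γ((n+1)/2)/√π`", with `2F_t(e^y) = e^{−y²/4t}/(√π√t)`). PROVED from Mathlib's
`integral_rpow_mul_exp_neg_mul_rpow`. [cite: Connes2024HeatExpansion, Lemma 3.2 proof, display (arXiv p0006:L44)] -/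
theorem integral_two_heatTest_mul_pow {t : ℝ} (ht : 0 < t) (n : ℕ) :
    ∫ y in Ioi (0:ℝ), Real.exp (-y ^ 2 / (4 * t)) / (√π * √t) * y ^ n
      = 2 ^ n * t ^ ((n : ℝ) / 2) * Real.Gamma (((n : ℝ) + 1) / 2) / √π := by
  have hb : (0 : ℝ) < 1 / (4 * t) := by positivity
  have key := integral_rpow_mul_exp_neg_mul_rpow (p := 2) (q := (n : ℝ)) two_pos
    (by have : (0:ℝ) ≤ n := n.cast_nonneg; linarith) hb
  have hcongr : ∫ y in Ioi (0:ℝ), Real.exp (-y ^ 2 / (4 * t)) / (√π * √t) * y ^ n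
      = (1 / (√π * √t)) * ∫ y in Ioi (0:ℝ), y ^ (n : ℝ) * Real.exp (-(1 / (4 * t)) * y ^ (2 : ℝ)) := by
    rw [← integral_const_mul]
    refine setIntegral_congr_fun measurableSet_Ioi (fun y hy => ?_)
    rw [Real.rpow_natCast, show (2 : ℝ) = ((2 : ℕ) : ℝ) by norm_num, Real.rpow_natCast]
    have : -(1 / (4 * t)) * y ^ 2 = -y ^ 2 / (4 * t) := by field_simp
    rw [this]
    field_simp
  rw [hcongr, key]
  have h1 : (1 / (4 * t)) ^ (-((n : ℝ) + 1) / 2) = 2 ^ ((n : ℝ) + 1) * t ^ (((n : ℝ) + 1) / 2) := by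
    rw [one_div, Real.inv_rpow (by positivity), ← Real.rpow_neg (by positivity), neg_div, neg_neg,
      Real.mul_rpow (by norm_num) ht.le, show (4 : ℝ) = 2 ^ (2 : ℝ) by norm_num, ← Real.rpow_mul (by norm_num)]
    congr 1; congr 1; ring
  rw [h1]
  have hsqt : √t = t ^ (1 / 2 : ℝ) := Real.sqrt_eq_rpow t
  have h2 : (2 : ℝ) ^ ((n : ℝ) + 1) = 2 * 2 ^ n := by
    rw [Real.rpow_add two_pos, Real.rpow_natCast, Real.rpow_one]; ring
  have h3 : t ^ (((n : ℝ) + 1) / 2) = t ^ ((n : ℝ) / 2) * t ^ (1 / 2 : ℝ) := by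
    rw [← Real.rpow_add ht]; congr 1; ring
  rw [h2, h3, hsqt]
  have hπ : 0 < √π := Real.sqrt_pos.mpr Real.pi_pos
  have ht2 : 0 < t ^ (1 / 2 : ℝ) := Real.rpow_pos_of_pos ht _
  field_simp

/-- The real integrand above is `2 F_t(e^y) = 2 · heatTest t y` (the test function is real and even).
[cite: Connes2024HeatExpansion, §3 first display (arXiv p0005:L4)] -/
theorem two_mul_heatTest (t y : ℝ) :
    2 * heatTest t y = ((Real.exp (-y ^ 2 / (4 * t)) / (√π * √t) : ℝ) : ℂ) := by
  simp only [heatTest]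
  push_cast
  ring

/-! ## The heat trace of the zeros and Theorem 1.1 (named fact, conditional on RH as printed) -/

/-- The term `m(ρ) e^{−t (Im ρ)²}` of the heat trace at a non-trivial zero `ρ` (multiplicity `m(ρ) =
riemannZetaZeroOrder ρ`). [cite: Connes2024HeatExpansion, Thm 1.1 (arXiv p0002:L8)] -/
def zetaHeatTerm (t : ℝ) (ρ : RHWave0.riemannZetaNontrivialZeros) : ℝ :=
  (riemannZetaZeroOrder (ρ : ℂ) : ℝ) * Real.exp (-t * (ρ : ℂ).im ^ 2)

/-- **The heat trace `Tr(exp(−tD²))`** of "the self-adjoint operator `D` whose spectrum is formed of the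
imaginary parts of non-trivial zeros of the Riemann zeta function" (Connes 2024 Thm 1.1; Letter Thm 7.3),
typed intrinsically as `Σ_ρ m(ρ) e^{−t (Im ρ)²}` over the non-trivial zeros with multiplicity (under RH the
`Im ρ` are the eigenvalues of `D`, counted with multiplicity; the operator itself is "putative" in print and is
not constructed). `tsum` (junk `0` if not summable; summability is part of the fact below).
[cite: Connes2024HeatExpansion, Thm 1.1 (arXiv p0002:L8); Connes2026Letter, Thm 7.3 (arXiv p0026:L10)] -/
def zetaHeatTrace (t : ℝ) : ℝ :=
  ∑' ρ : RHWave0.riemannZetaNontrivialZeros, zetaHeatTerm t ρ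

/-- The explicit part of the expansion: `log(1/t)/(4√π√t) − (log 4π + γ/2)/(2√π√t) + 2e^{t/4}` (the two
divergent terms and the polar term `F̂_t(i/2) + F̂_t(−i/2) = 2e^{t/4}`). [cite: Connes2024HeatExpansion, Thm 1.1 eq. (1.1) (arXiv p0002:L10)] -/
def heatMainTerm (t : ℝ) : ℝ :=
  Real.log (1 / t) / (4 * √π * √t)
    - (Real.log (4 * π) + Real.eulerMascheroniConstant / 2) / (2 * √π * √t)
    + 2 * Real.exp (t / 4)

/-- **Connes 2024, Theorem 1.1 = Connes 2026 Letter, Theorem 7.3** (NAMED FACT, no proof claimed; CONDITIONAL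
on RH as printed — RH places the zeros on the critical line so that `D` is self-adjoint; the proof in print is
RH-free analysis of the explicit formula: Bombieri's explicit formula [EB] applied to `F_t`, §3 archimedean
term via Lemmas 3.1–3.2, §4 primes `abs_heatPrimeSum_le`).  As printed: "Assume RH and let `D` be the
self-adjoint operator whose spectrum is formed of the imaginary parts of non-trivial zeros of the Riemann zeta
function. One then has the asymptotic expansion for `t → 0`
`Tr(exp(−tD²)) ∼ log(1/t)/(4√π√t) − (log 4π + ½γ)/(2√π√t) + 2exp(t/4) + Σ a_n t^{n/2}`
where `a_0 = −1/4` and for `k > 0`, using Bernouilli numbers `B_j` and Euler numbers `E(k)`,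
`a_{2k−1} = Γ(k)(2^{2k−1} − 1)B_{2k}/(2√π(2k)!)`, `a_{2k} = −¼ Γ(k+½) E(2k)/(√π(2k)!)`."  TYPED: under
Mathlib's `RiemannHypothesis`, the heat trace `zetaHeatTrace t = Σ_ρ m(ρ)e^{−t(Im ρ)²}` is summable for every
`t > 0` and, for every `N`, `zetaHeatTrace t − (heatMainTerm t + Σ_{n<N} a_n t^{n/2}) = O(t^{N/2})` as
`t → 0⁺` (`a_n = heatCoeff n`; the standard reading of an asymptotic expansion `∼ Σ a_n t^{n/2}`, which is what
the remainder estimate of Lemma 3.2's proof gives).  The printed remark "`E(2k)/(2k)! ∼ (−1)^k 2^{2k}(4/π)π^{−2k}`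
… the asymptotic expansion is by no means convergent" is commentary, not typed.  WHAT THIS IS NOT: a
construction of `D`, or anything bearing on RH (RH is a hypothesis of the statement, used only to name the
sum a heat trace). [cite: Connes2024HeatExpansion, Thm 1.1 (arXiv p0002:L8–L14); Connes2026Letter, Thm 7.3 §7.5 (arXiv p0026:L10–L16)] -/
def Connes2024_heat_thm_1_1 : Prop :=
  RiemannHypothesis →
    (∀ t : ℝ, 0 < t → Summable (zetaHeatTerm t)) ∧
      ∀ N : ℕ,
        (fun t : ℝ => zetaHeatTrace t - (heatMainTerm t + ∑ n ∈ range N, heatCoeff n * t ^ ((n : ℝ) / 2)))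
          =O[𝓝[>] 0] fun t : ℝ => t ^ ((N : ℝ) / 2)

end Literature.NumberTheory.LFunctions

end
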